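import Mathlib
import HarnessLib
import Summits.QuantumAdvantage.QuantumAdvantage.Theses.CubicForrelation
import Literature.Computability.QuantumComplexity.CubicForrelation
import Literature.Computability.Complexity.Promise
import Literature.Computability.Complexity.PromiseZPPProofs

/-!
# Sketch — crux-ideate `pl_lift` (stmt-QuantumAdvantage-0250), ideator 3, round 1 (rev 2, against route rev 7)

Idea card `rm-rigidity-exact-slice`: Reed–Muller / Walsh-integrality RIGIDITY below Φ = 1 (= the
route's rank-2 crux `NearExactIsExact`, stmt-14043) puts the SIGNED exact cubic Forrelation slice
(route item `SignedExactCubicForrelationNotPrBPP`, stmt-13932, its promise problem by `rfl` below)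
into `promiseLift BQP` — it is separated by an honest, everywhere-gapped BQP language —, so
(i) the LOCAL lift `BQP ⊆ BPP → signedExactSlice ∈ PromiseBPP'` is provable (the only use the
route's `closes` makes of `PlLift`), and (ii) with stmt-13932 the summit follows, hence `PlLift`.

Contents: K1 = `NearExactIsExact` (route decl; `RigidityGap` is the same statement with c = 1 - θ,
proved equivalent below); first lemma `RigidityGapMM` (MM-type family, provable now, c = 2⁻⁸);
`RigidityGapBentCubicDual` (branch A, provable now); K2 `SignedExactSliceIsLift`; PROVED assembly
logic `localLift_of_isLift`, `summit_of_isLift`, `plLift_of_isLift`.  lean check: rc 0, 0 sorry.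
-/

noncomputable section

namespace Summit.QuantumAdvantage.QuantumAdvantage.Cruxes.PlLift.RmRigidityExactSlice

open Literature.Computability.QuantumComplexity Literature.Computability.Complexity
  Literature.Computability.Cryptography
open Summit.QuantumAdvantage.QuantumAdvantage.Theses.CubicForrelation
  (PlLift NearExactIsExact SignedExactCubicForrelationNotPrBPP)

/-- **K1 in gap form.** Among cubic pairs the Forrelation value `1` is ISOLATED:
`Φ(f,g) < 1 ⟹ Φ(f,g) ≤ 1 - c` for an absolute `c > 0` (n even).  Equivalent to the route's
`NearExactIsExact` (θ = 1 - c), see `rigidityGap_iff_nearExactIsExact`.  Evidence: exhaustive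
value-set computations give `sup{Φ < 1} = 3/4` at n = 4 and `= 25/32` at n = 6 (kit j012447/j012547,
all affine classes; extremal `x·y + x₁x₂x₃ + y₁y₂y₃`); the Maiorana–McFarland-type family is a
theorem (`RigidityGapMM`); g bent with dual of degree d gives `Φ ≤ 1 - 2^{1-d}`; conjectured sharp
constant `c = 1/8` (7/8 attained at n = 10, T-family, refuter 494f1478 on stmt-2202). -/
def RigidityGap : Prop :=
  ∃ c : ℝ, 0 < c ∧ ∀ n : ℕ, Even n → ∀ f g : (Fin n → Bool) → Bool, IsDegLeFun 3 f → IsDegLeFun 3 g →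
    forrelation f g < 1 → forrelation f g ≤ 1 - c

/-- `|Φ| ≤ 1` — needed once below; the tree proves it (`abs_forrelation_le_one`-type lemmas exist in
the Forrelation files); to keep this sketch import-light we take it as a hypothesis of the `iff`. -/
def ForrelationLeOne : Prop := ∀ (n : ℕ) (f g : (Fin n → Bool) → Bool), forrelation f g ≤ 1

theorem rigidityGap_iff_nearExactIsExact (hle : ForrelationLeOne) : RigidityGap ↔ NearExactIsExact := by
  constructor
  · rintro ⟨c, hc, H⟩
    refine ⟨1 - c, by linarith, fun n hn f g hf hg hθ => ?_⟩
    by_contra hne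
    have hlt : forrelation f g < 1 := lt_of_le_of_ne (hle n f g) hne
    have := H n hn f g hf hg hlt
    linarith
  · rintro ⟨θ, hθ, H⟩
    refine ⟨1 - θ, by linarith, fun n hn f g hf hg hlt => ?_⟩
    by_contra hgt
    push_neg at hgt
    have h1 : forrelation f g = 1 := H n hn f g hf hg (by linarith)
    linarith

/-- The Maiorana–McFarland-TYPE function `g(x,y) = x·π(y) + h(y)` on `𝔽₂^{m+m}` built from an
ARBITRARY map `π : 𝔽₂^m → 𝔽₂^m` given by `m` polynomials and a polynomial `h`
(`x` = first block, `y` = second block). Bent iff `π` is a permutation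
(Carlet 2020, Prop. 77 and eq. (6.10): `W_g(u,v) = 2^{m} Σ_{y ∈ π⁻¹(u)} (-1)^{h(y)+v·y}`). -/
def mmType (m : ℕ) (π : Fin m → MvPolynomial (Fin m) (ZMod 2)) (h : MvPolynomial (Fin m) (ZMod 2)) :
    (Fin (m + m) → Bool) → Bool := fun z =>
  let yv : Fin m → ZMod 2 := fun j => if z (Fin.natAdd m j) then 1 else 0
  decide ((∑ i : Fin m, (if z (Fin.castAdd m i) then (1 : ZMod 2) else 0) * MvPolynomial.eval yv (π i))
      + MvPolynomial.eval yv h = 1)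

/-- **First lemma (support S1, provable now; the MM-type case of K1 with explicit constant).**
For every `m`, `π` ANY quadratic map (not necessarily bijective), `h` cubic, `f` cubic:
`Φ(f, x·π(y)+h(y)) < 1 ⟹ Φ ≤ 1 - 2⁻⁸`.  Proof (card / NOTES): Walsh integrality on fibres
(Carlet eq. 6.10) + the v-linear coefficient of a cubic `f(u,v)` is a QUADRATIC map `A(u)` that
must invert `π` wherever `f` matches `sgn W_g`; a quadratic `A` with `A∘π = id` off fewer than
`2^{m-4}` points has `A∘π = id` identically (coordinates in RM(4,m)), forcing `π` bijective with
quadratic inverse, and then `h∘π⁻¹` cubic (RM(6,m)) — i.e. `Φ = 1`; otherwise Reed–Muller weight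
budgets leave a defect `≥ 2⁻⁸`. -/
def RigidityGapMM : Prop :=
  ∀ m : ℕ, ∀ (π : Fin m → MvPolynomial (Fin m) (ZMod 2)) (h : MvPolynomial (Fin m) (ZMod 2)),
    (∀ i, (π i).totalDegree ≤ 2) → h.totalDegree ≤ 3 →
    ∀ f : (Fin (m + m) → Bool) → Bool, IsDegLeFun 3 f →
      forrelation f (mmType m π h) < 1 → forrelation f (mmType m π h) ≤ 1 - 1 / 256

/-- **Branch (A), provable now from the one-sided identity + d_min(RM(3,n)) = 2^{n-3}:** if
`(f₀, g₀)` is an EXACT pair with `f₀` cubic then every cubic `f ≠ f₀` has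
`Φ(f, g₀) = 1 - 2·dist(f,f₀)/2ⁿ ≤ 3/4`. -/
def RigidityGapBentCubicDual : Prop :=
  ∀ (n : ℕ) (f₀ g₀ f : (Fin n → Bool) → Bool), IsDegLeFun 3 f₀ → IsDegLeFun 3 f →
    forrelation f₀ g₀ = 1 → forrelation f g₀ < 1 → forrelation f g₀ ≤ 3 / 4

/-- The SIGNED exact cubic slice: literally the promise problem of route item
`SignedExactCubicForrelationNotPrBPP` (stmt-13932; yes: cubic pairs over B₂, n even, Φ = 1;
no: the same with Φ = -1). -/
def signedExactSlice : PromiseProblem :=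
  ⟨KForrelationInstance.encode '' {I | I.IsOverB2 ∧ I.value = 1 ∧ I.k = 2 ∧ Even I.n ∧ ∀ i, IsDegLeFun 3 (I.C i).eval},
   KForrelationInstance.encode '' {I | I.IsOverB2 ∧ I.value = -1 ∧ I.k = 2 ∧ Even I.n ∧ ∀ i, IsDegLeFun 3 (I.C i).eval}⟩

/-- Sanity: the route's rank-3 crux is `signedExactSlice ∉ PromiseBPP'` on the nose. -/
example : SignedExactCubicForrelationNotPrBPP = (signedExactSlice ∉ PromiseBPP') := rfl

/-- **K2 (crux, rank 3 — support-grade modulo the route's own PromiseBQP plumbing 13934).**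
Isolation of exactness puts the signed exact slice into the promise LIFT of BQP: the language
`L₊ = {x : x parses as (k = 2, n even, circuits C₀, C₁); a*, b* := the degree-≤3 ANFs INTERPOLATED
from the circuits' values on the points of weight ≤ 3; Φ((-1)^{a*},(-1)^{b*}) = 1}` is decided by
the Hadamard-test family of route support 13934 run on the phase oracles of a*, b* (acceptance
EXACTLY (1+Φ)/2 ∈ {1} ∪ [0, (1+θ)/2] on every input, by `NearExactIsExact`), and `yes ⊆ L₊`,
`no ∩ L₊ = ∅` (Φ = 1 resp. -1 on the promise, where a* = a, b* = b). -/
def SignedExactSliceIsLift : Prop :=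
  NearExactIsExact → signedExactSlice ∈ promiseLift BQP

/-- Assembly logic 1 (the LOCAL, non-vacuous form of PL at the route's use-site): given K2's
conclusion, `BQP ⊆ BPP` dequantizes the signed exact slice (promiseLift_mono +
PromiseBPP ⊆ PromiseBPP', both in tree). -/
theorem localLift_of_isLift (h : signedExactSlice ∈ promiseLift BQP) :
    BQP ⊆ BPP → signedExactSlice ∈ PromiseBPP' := fun hc =>
  PromiseBPP_subset_PromiseBPP'_holds (promiseLift_mono hc h)

/-- Assembly logic 2: with the route's own rank-3 crux (classical hardness of the signed exact
slice, hypothesis-grade as in every S-route) the summit follows WITHOUT the global lift … -/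
theorem summit_of_isLift (h : signedExactSlice ∈ promiseLift BQP)
    (hr3 : SignedExactCubicForrelationNotPrBPP) : QuantumAdvantage := by
  by_contra hS
  refine hr3 (localLift_of_isLift h fun L hL => ?_)
  by_contra hLn
  exact hS ⟨L, hL, hLn⟩

/-- … and hence the crux `PlLift` itself (S → PL: the antecedent `BQP ⊆ BPP` is refuted). -/
theorem plLift_of_isLift (h : signedExactSlice ∈ promiseLift BQP)
    (hr3 : SignedExactCubicForrelationNotPrBPP) : PlLift := by
  intro hc
  exact absurd (summit_of_isLift h hr3) fun ⟨L, hL, hLn⟩ => hLn (hc hL)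

/-- The intended replacement for the route's deciding theorem: two hypotheses, no lift. -/
theorem closes' (h14043 : NearExactIsExact) (hK2 : SignedExactSliceIsLift)
    (hr3 : SignedExactCubicForrelationNotPrBPP) : QuantumAdvantage :=
  summit_of_isLift (hK2 h14043) hr3

end Summit.QuantumAdvantage.QuantumAdvantage.Cruxes.PlLift.RmRigidityExactSlice
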